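import Literature.AlgebraicGeometry.Frobenioids.PadicFrobenioidSplittingMonoid
import Mathlib.Algebra.Group.Submonoid.Membership
import HarnessLib

/-!
# Frobenioids II, Example 1.1 (ii): the absolutely primitive `p`-adic Frobenioid `Φ = ℤ_{≥0} · ord(ℚ_p^×)` over a base

Mochizuki, *The geometry of Frobenioids II*, Kyushu J. Math. **62** (2008) 401–460, §1, Example 1.1 (ii),
pp. 8–9 [cite: MochizukiFrdII2008, Ex 1.1 (ii) pp.8-9]: for a connected, totally epimorphic category `D` with a
functor `D → D₀`, a monoprime subfunctor in monoids `Φ ⊆ Φ₀|_D` with `B := B₀|_D ×_{Φ₀^gp|_D} Φ^gp → Φ^gp`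
nonzero determines the `p`-adic Frobenioid of this data; "if it holds that `Φ(K) ⊆ Λ · ord(ℚ_p^×)` … for every
`Spec(K) ∈ Ob(D₀)`, then we shall say that `Φ` is *absolutely primitive*".

This file CONSTRUCTS the canonical absolutely primitive datum (`Λ = ℤ`) over an arbitrary base functor
`base : D ⥤ PadicFld p` into `p`-adic local fields — the choice `Φ(K) = ℤ_{≥0} · ord(ℚ_p^×)` itself, i.e.
`Φ^⊢(A) := {ord(p)^n ⊗ 1} ⊆ Φ₀(A) = ord(O_{K_A}^⊳) ⊗ ℝ_{≥0}` (this is the monoid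
"`Φ_{C_v^⊢} : Spec L ↦ ord(ℤ_{p_v}^⊳)`" of [IUTchI] Ex. 3.3 (i) over `D_v^⊢`):

* `primGen base A` — `ord(p) ⊗ 1 ∈ Φ₀(A)`, fixed by all restriction maps (`phi0Map_primGen`), with
  injective powers (`primGen_pow_injective`: `Φ₀(A)` is cancellative and sharp, abc-iut-L1-d10's
  `isMonoprime_ordInt` realified, and `ord(p) ≠ 0`);
* `primΦ base : Dᵒᵖ ⥤ CommMon` — `A ↦` the submonoid of powers of `ord(p) ⊗ 1`, with its inclusion `primι` into
  `Φ₀|_D` and BIJECTIVE pull-back maps (`primΦ_map_bijective`);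
* `primB base` — the fibre product `B₀|_D ×_{Φ₀^gp|_D} (Φ^⊢)^gp` as the equaliser submonoid of
  `K_A^× × (Φ^⊢(A))^gp`, with its projections;
* `Datum.prim base hloc hc he : Datum D p` — **the absolutely primitive `p`-adic Frobenioid datum** over the
  base (`Φ^⊢` is `ℤ`-monoprime, the square is cartesian by construction, `Div_B` is nonzero on the lift of `p`),
  `Datum.prim_isAbsolutelyPrimitive` — it IS absolutely primitive (the first inhabitant of
  `Datum.IsAbsolutelyPrimitive` in the tree: it de-vacuates Thm. 1.2 (v) / `Datum.pSplitting` and Remarks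
  1.2.1–1.2.2 for every base), `Datum.prim_map_Φ_bijective` — all its pull-back maps are bijective.

Dictionary as in `PadicFrobenioid.lean`; no statement of the paper is strengthened.
-/

noncomputable section

namespace Literature.AlgebraicGeometry.Frobenioids

namespace PadicFrd

open CategoryTheory Opposite Function ValuativeRel

universe v u

variable {D : Type u} [Category.{v} D] {p : ℕ} (base : D ⥤ PadicFld.{u} p)

/-! ### The generator `ord(p) ⊗ 1 ∈ Φ₀(A)` -/

/-- `ord(p) ⊗ 1 ∈ Φ₀(A) = ord(O_{K_A}^⊳) ⊗ ℝ_{≥0}`, the image of the class of `p ∈ O_{K_A}^⊳` ("`ord(ℚ_p^×)`",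
FrdII Ex. 1.1 (ii) p. 8, generated by `ord(p)`). [cite: MochizukiFrdII2008, Ex 1.1 (ii) p.8] -/
def primGen (A : D) : Realification (OrdInt (base.obj A).K) :=
  Realification.of (OrdInt (base.obj A).K) (Associates.mk ⟨((p : ℕ) : (base.obj A).K), (base.obj A).p_mem⟩)

/-- The pull-back map of `Φ₀|_D` along an arrow `f` of `Dᵒᵖ`, over the concrete monoids
`ord(O_K^⊳) ⊗ ℝ_{≥0}` (typed accessor for `((phiZeroOn base).map f).hom`). [cite: MochizukiFrdII2008, Ex 1.1 (i) p.7] -/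
def phi0Map {A A' : Dᵒᵖ} (f : A ⟶ A') :
    Realification (OrdInt (base.obj A.unop).K) →* Realification (OrdInt (base.obj A'.unop).K) :=
  ((phiZeroOn base).map f).hom

/-- `phi0Map` of an identity is the identity. [cite: MochizukiFrdII2008, Ex 1.1 (i) p.7] -/
theorem phi0Map_id (A : Dᵒᵖ) : phi0Map base (𝟙 A) = MonoidHom.id _ := by
  have h : ((phiZeroOn base).map (𝟙 A)).hom = (𝟙 ((phiZeroOn base).obj A) : _ ⟶ _).hom := by
    rw [(phiZeroOn base).map_id]
  rw [CommMonCat.hom_id] at h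
  exact h

/-- `phi0Map` of a composite is the composite. [cite: MochizukiFrdII2008, Ex 1.1 (i) p.7] -/
theorem phi0Map_comp {A A' A'' : Dᵒᵖ} (f : A ⟶ A') (g : A' ⟶ A'') :
    phi0Map base (f ≫ g) = (phi0Map base g).comp (phi0Map base f) := by
  have h : ((phiZeroOn base).map (f ≫ g)).hom = ((phiZeroOn base).map f ≫ (phiZeroOn base).map g).hom := by
    rw [(phiZeroOn base).map_comp]
  rw [CommMonCat.hom_comp] at h
  exact h

/-- The restriction maps of `Φ₀|_D` fix `ord(p) ⊗ 1` (field homomorphisms fix `p`).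
[cite: MochizukiFrdII2008, Ex 1.1 (ii) p.8] -/
theorem phi0Map_primGen {A A' : Dᵒᵖ} (f : A ⟶ A') : phi0Map base f (primGen base A.unop) = primGen base A'.unop := by
  change Realification.map (ordIntMapOfHom (base.map f.unop).alg (base.map f.unop).isValHom) (primGen base A.unop) = _
  rw [primGen, Realification.map_of, ordIntMapOfHom_mk, primGen]
  congr 2
  exact Subtype.ext (map_natCast (base.map f.unop).alg p)

/-! ### The subfunctor `Φ^⊢ = ℤ_{≥0} · ord(p) ⊆ Φ₀|_D` -/

/-- The pull-back map of `Φ^⊢` along `f` (in `Dᵒᵖ`): the restriction of that of `Φ₀|_D` to the powers of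
`ord(p) ⊗ 1`, which it preserves. [cite: MochizukiFrdII2008, Ex 1.1 (ii) p.8] -/
def primΦMap {A A' : Dᵒᵖ} (f : A ⟶ A') :
    Submonoid.powers (primGen base A.unop) →* Submonoid.powers (primGen base A'.unop) :=
  ((phi0Map base f).restrict (Submonoid.powers (primGen base A.unop))).codRestrict _ fun x => by
    obtain ⟨n, hn⟩ := x.2
    refine ⟨n, ?_⟩
    change primGen base A'.unop ^ n = phi0Map base f x.1
    rw [← hn, map_pow, phi0Map_primGen]

/-- The value of the pull-back map of `Φ^⊢`. [cite: MochizukiFrdII2008, Ex 1.1 (ii) p.8] -/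
@[simp] theorem coe_primΦMap {A A' : Dᵒᵖ} (f : A ⟶ A') (x : Submonoid.powers (primGen base A.unop)) :
    (primΦMap base f x : Realification (OrdInt (base.obj A'.unop).K)) = phi0Map base f x.1 := rfl

/-- **`Φ^⊢ := ℤ_{≥0} · ord(ℚ_p^×) ⊆ Φ₀|_D`** as a functor `Dᵒᵖ → CommMon`: `A ↦` the powers of `ord(p) ⊗ 1`
(the divisor monoid of the absolutely primitive `p`-adic Frobenioid `C^⊢`; [IUTchI] Ex. 3.3 (i)
"`Φ_{C_v^⊢} : Spec L ↦ ord(ℤ_{p_v}^⊳)`"). [cite: MochizukiFrdII2008, Ex 1.1 (ii) p.8] -/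
def primΦ : Dᵒᵖ ⥤ CommMonCat.{u} where
  obj A := CommMonCat.of (Submonoid.powers (primGen base A.unop))
  map f := CommMonCat.ofHom (primΦMap base f)
  map_id A := by
    apply CommMonCat.hom_ext
    refine MonoidHom.ext fun x => Subtype.ext ?_
    show phi0Map base (𝟙 A) x.1 = x.1
    rw [phi0Map_id]
    rfl
  map_comp f g := by
    apply CommMonCat.hom_ext
    refine MonoidHom.ext fun x => Subtype.ext ?_
    show phi0Map base (f ≫ g) x.1 = phi0Map base g (phi0Map base f x.1)
    rw [phi0Map_comp]
    rfl

/-- The inclusion `Φ^⊢ ↪ Φ₀|_D`. [cite: MochizukiFrdII2008, Ex 1.1 (ii) p.8] -/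
def primι : primΦ base ⟶ phiZeroOn base where
  app A := CommMonCat.ofHom (Submonoid.subtype _)
  naturality {A A'} f := by
    apply CommMonCat.hom_ext
    exact MonoidHom.ext fun x => rfl

/-- The inclusion is objectwise injective. [cite: MochizukiFrdII2008, Ex 1.1 (ii) p.8] -/
theorem primι_injective (A : Dᵒᵖ) : Injective ((primι base).app A).hom := Subtype.val_injective

/-! ### The fibre product `B^⊢ := B₀|_D ×_{Φ₀^gp|_D} (Φ^⊢)^gp` -/

/-- `B^⊢(A) ⊆ K_A^× × (Φ^⊢(A))^gp`: the pairs `(x, γ)` with `Div₀(x) = ι^gp(γ)` (the fibre product of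
FrdII Ex. 1.1 (ii), p. 8, as an equaliser submonoid). [cite: MochizukiFrdII2008, Ex 1.1 (ii) p.8] -/
def primBSub (A : Dᵒᵖ) :
    Submonoid ((bZeroOn base).obj A × Algebra.GrothendieckGroup ((primΦ base).obj A)) :=
  MonoidHom.eqLocusM (((divZeroOn base).app A).hom.comp (MonoidHom.fst _ _))
    (((Functor.whiskerRight (primι base) MonGp.functor).app A).hom.comp (MonoidHom.snd _ _))

/-- Membership in `B^⊢(A)`. [cite: MochizukiFrdII2008, Ex 1.1 (ii) p.8] -/
theorem mem_primBSub_iff (A : Dᵒᵖ) (q : (bZeroOn base).obj A × Algebra.GrothendieckGroup ((primΦ base).obj A)) :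
    q ∈ primBSub base A ↔
      ((divZeroOn base).app A).hom q.1 = ((Functor.whiskerRight (primι base) MonGp.functor).app A).hom q.2 :=
  Iff.rfl

/-- The pull-back map of `B^⊢` along `f`: `(x, γ) ↦ (B₀(f)(x), (Φ^⊢)^gp(f)(γ))`, which preserves the fibre
product condition by naturality of `B₀ → Φ₀^gp` and of `ι`. [cite: MochizukiFrdII2008, Ex 1.1 (ii) p.8] -/
def primBMap {A A' : Dᵒᵖ} (f : A ⟶ A') : primBSub base A →* primBSub base A' :=
  ((MonoidHom.prodMap ((bZeroOn base).map f).hom ((monoidGp (primΦ base)).map f).hom).comp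
    (Submonoid.subtype _)).codRestrict _ fun q => by
    obtain ⟨⟨x, γ⟩, hq⟩ := q
    have hq' : ((divZeroOn base).app A).hom x =
        ((Functor.whiskerRight (primι base) MonGp.functor).app A).hom γ := hq
    have n1 := congrArg (fun φ => φ.hom x) ((divZeroOn base).naturality f)
    have n2 := congrArg (fun φ => φ.hom γ) ((Functor.whiskerRight (primι base) MonGp.functor).naturality f)
    simp only [CommMonCat.hom_comp, MonoidHom.comp_apply] at n1 n2
    show ((divZeroOn base).app A').hom (((bZeroOn base).map f).hom x) =
      ((Functor.whiskerRight (primι base) MonGp.functor).app A').hom (((monoidGp (primΦ base)).map f).hom γ)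
    exact n1.trans ((congrArg ((monoidGp (phiZeroOn base)).map f).hom hq').trans n2.symm)

/-- **`B^⊢ := B₀|_D ×_{Φ₀^gp|_D} (Φ^⊢)^gp`** as a functor `Dᵒᵖ → CommMon`. [cite: MochizukiFrdII2008, Ex 1.1 (ii) p.8] -/
def primB : Dᵒᵖ ⥤ CommMonCat.{u} where
  obj A := CommMonCat.of (primBSub base A)
  map f := CommMonCat.ofHom (primBMap base f)
  map_id A := by
    apply CommMonCat.hom_ext
    refine MonoidHom.ext fun q => Subtype.ext (Prod.ext ?_ ?_)
    · exact (DFunLike.congr_fun (congrArg CommMonCat.Hom.hom ((bZeroOn base).map_id A)) q.1.1).trans rfl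
    · exact (DFunLike.congr_fun (congrArg CommMonCat.Hom.hom ((monoidGp (primΦ base)).map_id A)) q.1.2).trans rfl
  map_comp f g := by
    apply CommMonCat.hom_ext
    refine MonoidHom.ext fun q => Subtype.ext (Prod.ext ?_ ?_)
    · exact (DFunLike.congr_fun (congrArg CommMonCat.Hom.hom ((bZeroOn base).map_comp f g)) q.1.1).trans rfl
    · exact (DFunLike.congr_fun (congrArg CommMonCat.Hom.hom ((monoidGp (primΦ base)).map_comp f g)) q.1.2).trans
        rfl

/-- The first projection `B^⊢ → B₀|_D` ("`u ↦ u|_{K^×}`"). [cite: MochizukiFrdII2008, Ex 1.1 (ii) p.8] -/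
def primToB0 : primB base ⟶ bZeroOn base where
  app A := CommMonCat.ofHom ((MonoidHom.fst _ _).comp (Submonoid.subtype _))
  naturality {A A'} f := by
    apply CommMonCat.hom_ext
    exact MonoidHom.ext fun q => rfl

/-- The second projection `Div_B : B^⊢ → (Φ^⊢)^gp`. [cite: MochizukiFrdII2008, Ex 1.1 (ii) p.8] -/
def primDivB : primB base ⟶ monoidGp (primΦ base) where
  app A := CommMonCat.ofHom ((MonoidHom.snd _ _).comp (Submonoid.subtype _))
  naturality {A A'} f := by
    apply CommMonCat.hom_ext
    exact MonoidHom.ext fun q => rfl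

/-- The element of `B^⊢(A)` over `(p, ord(p))`: the lift of `p ∈ ℚ_p^×` ("the image of `p` in `K^×`",
FrdII p. 10), witnessing that `Div_B` is nonzero. [cite: MochizukiFrdII2008, Ex 1.1 (ii) p.8] -/
def primLiftP (A : Dᵒᵖ) : primBSub base A :=
  ⟨(intNonzeroToUnits (base.obj A.unop).K ⟨((p : ℕ) : (base.obj A.unop).K), (base.obj A.unop).p_mem⟩,
    Algebra.GrothendieckGroup.of (⟨primGen base A.unop, Submonoid.mem_powers _⟩ : Submonoid.powers _)), by
    rw [mem_primBSub_iff]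
    change divZeroHom (base.obj A.unop).K (intNonzeroToUnits _ _) =
      MonGp.map ((primι base).app A).hom (Algebra.GrothendieckGroup.of _)
    rw [divZeroHom_intNonzeroToUnits, MonGp.map_of]
    rfl⟩

/-! ### Arithmetic input: `ord(p) ⊗ 1` is non-torsion (base objects finite over `ℚ_p`) -/

section PadicLocal

variable [Fact p.Prime]

/-- `ord(p) ⊗ 1 ≠ 1` in `Φ₀(A)` for a `p`-adic local field `K_A` (`v(p) < 1`, and `ord(O_K^⊳) → Φ₀` is
injective since `ord(O_K^⊳)` is monoprime, abc-iut-L1-d10). [cite: MochizukiFrdII2008, Ex 1.1 (i) p.7] -/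
theorem primGen_ne_one {A : D} (hloc : (base.obj A).IsPadicLocal) : primGen base A ≠ 1 := by
  obtain ⟨⟨inst, hfin, hc⟩⟩ := hloc
  letI := inst
  haveI := hfin
  intro h
  have h2 : Associates.mk (⟨((p : ℕ) : (base.obj A).K), (base.obj A).p_mem⟩ : intNonzero (base.obj A).K) = 1 :=
    Realification.of_injective (isMonoprime_ordInt hc) (h.trans (map_one _).symm)
  rw [Associates.mk_eq_one] at h2
  exact (base.obj A).p_lt.ne ((isUnit_intNonzero_iff _ _).mp h2)

/-- The powers of `ord(p) ⊗ 1` are distinct (`Φ₀(A)` is cancellative and sharp, `ord(p) ⊗ 1 ≠ 1`), so that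
`ℤ_{≥0} · ord(p) ≅ ℤ_{≥0}`. [cite: MochizukiFrdII2008, Ex 1.1 (ii) p.8] -/
theorem primGen_pow_injective {A : D} (hloc : (base.obj A).IsPadicLocal) :
    Injective fun n : ℕ => primGen base A ^ n := by
  obtain ⟨⟨inst, hfin, hc⟩⟩ := id hloc
  letI := inst
  haveI := hfin
  haveI := isCancelMul_realification (OrdInt (base.obj A).K)
  have hsharp : IsSharp (Realification (OrdInt (base.obj A).K)) :=
    (IsMonoprime.ofR (isRMonoprime_realification (isMonoprime_ordInt hc))).isSharp
  have key : ∀ m n : ℕ, m < n → primGen base A ^ m = primGen base A ^ n → False := by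
    intro m n hlt hmn
    have h2 : primGen base A ^ m * primGen base A ^ (n - m) = primGen base A ^ m * 1 := by
      rw [← pow_add, Nat.add_sub_cancel' hlt.le, ← hmn, mul_one]
    exact primGen_ne_one base hloc
      (hsharp.1 _ (IsUnit.of_pow_eq_one (mul_left_cancel h2) (Nat.sub_ne_zero_of_lt hlt)))
  intro m n hmn
  by_contra hne
  rcases Nat.lt_or_gt_of_ne hne with hlt | hlt
  · exact key m n hlt hmn
  · exact key n m hlt hmn.symm

/-- **All pull-back maps of `Φ^⊢` are bijective** (`ord(p)^n ⊗ 1 ↦ ord(p)^n ⊗ 1`): in particular `Φ^⊢` is a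
monoid on `D` for every base ([FrdI] Def. 1.1 (ii)), and the constancy hypothesis of the repaired reading of
Rmk. 1.2.2 holds for it. [cite: MochizukiFrdII2008, Ex 1.1 (ii) p.8] -/
theorem primΦ_map_bijective (hloc : ∀ A : D, (base.obj A).IsPadicLocal) {A A' : Dᵒᵖ} (f : A ⟶ A') :
    Bijective ((primΦ base).map f).hom := by
  have hval : ∀ n : ℕ, phi0Map base f (primGen base A.unop ^ n) = primGen base A'.unop ^ n := fun n => by
    rw [map_pow, phi0Map_primGen]
  constructor
  · rintro ⟨x, n, rfl⟩ ⟨y, m, rfl⟩ h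
    have h' : phi0Map base f (primGen base A.unop ^ n) = phi0Map base f (primGen base A.unop ^ m) :=
      congrArg Subtype.val h
    rw [hval, hval] at h'
    have hnm : n = m := primGen_pow_injective base (hloc _) h'
    subst hnm
    rfl
  · rintro ⟨y, n, rfl⟩
    exact ⟨⟨primGen base A.unop ^ n, n, rfl⟩, Subtype.ext (hval n)⟩

/-! ### The absolutely primitive datum -/

/-- **The absolutely primitive `p`-adic Frobenioid datum** over a base `D → D₀` of `p`-adic local fields
(FrdII Ex. 1.1 (ii) with `Φ := ℤ_{≥0} · ord(ℚ_p^×)|_D`, `Λ = ℤ`; the datum of `C_v^⊢` in [IUTchI] Ex. 3.3 (i)):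
`Φ^⊢ ⊆ Φ₀|_D` is a `ℤ`-monoprime subfunctor in monoids, `B^⊢ := B₀|_D ×_{Φ₀^gp} (Φ^⊢)^gp` is cartesian by
construction, and `Div_B` is nonzero on the lift of `p`. Hypotheses as for `Datum.zero`: the base objects are
finite extensions of `ℚ_p` (`hloc`), `D` is connected and totally epimorphic. [cite: MochizukiFrdII2008, Ex 1.1 (ii) p.8] -/
def Datum.prim (hloc : ∀ A : D, (base.obj A).IsPadicLocal) (hc : IsConnected D) (he : IsTotallyEpimorphic D) :
    Datum D p where
  base := base
  isPadicLocal := hloc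
  isConnected_base := hc
  isTotallyEpimorphic_base := he
  Φ := primΦ base
  ι := primι base
  ι_injective := primι_injective base
  isMonoprime A := by
    classical
    exact IsMonoprime.ofZ ⟨⟨(Submonoid.powLogEquiv (primGen_pow_injective base (hloc A.unop))).symm⟩⟩
  B := primB base
  toB0 := primToB0 base
  divB := primDivB base
  square := by
    refine NatTrans.ext (funext fun A => ?_)
    rw [NatTrans.comp_app, NatTrans.comp_app]
    apply CommMonCat.hom_ext
    rw [CommMonCat.hom_comp, CommMonCat.hom_comp]
    exact MonoidHom.ext fun q => q.2
  cartesian A := by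
    constructor
    · intro b b' h
      exact Subtype.ext (congrArg Subtype.val h)
    · rintro ⟨q, hq⟩
      exact ⟨⟨q, hq⟩, rfl⟩
  nonzero A := by
    refine ⟨primLiftP base A, fun h => primGen_ne_one base (hloc A.unop) ?_⟩
    haveI := isCancelMul_realification (OrdInt (base.obj A.unop).K)
    have h1 : Algebra.GrothendieckGroup.of
        (⟨primGen base A.unop, Submonoid.mem_powers _⟩ : Submonoid.powers (primGen base A.unop)) = 1 := h
    have h2 := congrArg (MonGp.map (Submonoid.powers (primGen base A.unop)).subtype) h1
    rw [MonGp.map_of, map_one, Submonoid.subtype_apply] at h2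
    exact Algebra.GrothendieckGroup.of_injective (h2.trans (map_one _).symm)

/-- **The datum `Φ^⊢` IS absolutely primitive**: `Φ^⊢(K) = ℤ_{≥0} · ord(p) ⊆ ℤ · ord(ℚ_p^×)` (FrdII Ex. 1.1 (ii),
pp. 8–9). [cite: MochizukiFrdII2008, Ex 1.1 (ii) pp.8-9] -/
theorem Datum.prim_isAbsolutelyPrimitive (hloc : ∀ A : D, (base.obj A).IsPadicLocal) (hc : IsConnected D)
    (he : IsTotallyEpimorphic D) : (Datum.prim base hloc hc he).IsAbsolutelyPrimitive := by
  rintro A ⟨x, n, rfl⟩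
  change _ ∈ ((Datum.prim base hloc hc he).ordQpSubgroup A :
    Set (Algebra.GrothendieckGroup (Realification (OrdInt ((Datum.prim base hloc hc he).fld A)))))
  rw [SetLike.mem_coe]
  refine Subgroup.mem_zpowers_iff.mpr ⟨n, ?_⟩
  rw [zpow_natCast]
  exact (map_pow (Algebra.GrothendieckGroup.of (M := Realification (OrdInt (base.obj A).K)))
    (primGen base A) n).symm

/-- All pull-back maps of the divisor monoid `Φ^⊢` of the absolutely primitive datum are bijective.
[cite: MochizukiFrdII2008, Ex 1.1 (ii) p.8] -/
theorem Datum.prim_map_Φ_bijective (hloc : ∀ A : D, (base.obj A).IsPadicLocal) (hc : IsConnected D)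
    (he : IsTotallyEpimorphic D) {A A' : D} (f : A ⟶ A') :
    Bijective ((Datum.prim base hloc hc he).Φ.map f.op).hom :=
  primΦ_map_bijective base hloc f.op

end PadicLocal

end PadicFrd

end Literature.AlgebraicGeometry.Frobenioids
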